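import Summits.AnomalousDissipation.AnomalousDissipation.Theorems.SolenoidalFractalHomogenisationLagrangianStepSidebandXEnergyDecay
import Summits.AnomalousDissipation.AnomalousDissipation.Theorems.SolenoidalFractalHomogenisationLagrangianStepSidebandXDefectCommutator
import Summits.AnomalousDissipation.AnomalousDissipation.Theorems.SolenoidalFractalHomogenisationLagrangianStepSidebandMeanSlot
import Summits.AnomalousDissipation.AnomalousDissipation.Theorems.SolenoidalFractalHomogenisationLagrangianStepSidebandResponseExtContinuous
import Summits.AnomalousDissipation.AnomalousDissipation.Theorems.SolenoidalFractalHomogenisationLagrangianStepSidebandXSlowDefs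
import Mathlib.MeasureTheory.Integral.IntervalIntegral.Periodic
import HarnessLib

/-!
# K1L_D `LagrangianRenormalisationStepDesign` (stmt-AnomalousDissipation-27980), `stub_D1_V0` (V0 = clause (ii) of
# `WCrossing.D1ExactFamily`), brick T5: THE SLOW EQUATION IN FORCED FORM `x' = −(4π²P_ℓT_{𝔹ᵀ}(ℓ)x + slowPert t x) + slowForcing t`, the sizes of the
# perturbation and of the forcing, periodicity, continuity and the window means of the perturbation
# (helper; `--kind proof --supports stmt-AnomalousDissipation-27980 --as helper`)

Summits-side helper file of route `SolenoidalFractalHomogenisation` (prover seat `ad-k1l-cellLawV-w1` g7; 0 sorry, no defs, no named facts).  Brick T5 of the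
V0 memo `Cruxes/LagrangianRenormalisationStepDesign/Lines/onelevel-V0-residual.md` §4, in the shape consumed by the forced averaging lemma
`Literature.Analysis.ODE.PeriodicAveraging.norm_sub_exp_apply_le_forced` (objects `slowPert`, `slowMean`, `slowForcing` of `…SidebandXSlowDefs`;
`x = modeRep … ℓ`, `Z = sbVec`, `y = refState`, `r = residualX`, `ξ = √|ℓ|²/n`, `C_f = Σⱼ 4π‖αⱼ‖`, `C_N = Σⱼ 8π‖αⱼ‖/min(1,4π²lo)`):
* **`hasDerivAt_slow_forced`** — on `(0,T)`: `x' = −(4π²P_ℓT_{𝔹ᵀ}(ℓ) x + slowPert t x) + slowForcing t` (`…SidebandXChain.hasDerivAt_slowRep` + `Z = r + projX y`);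
* `opNorm_feedback_le`, **`norm_slowPert_le`** (`‖slowPert t‖ ≤ ξ²·C_f·C_N`), `norm_projX_refState_sub_le` (`‖projX y − y‖ ≤ 2ξ‖y‖`, `2|ℓ| ≤ n`),
  **`norm_slowForcing_le`** (`‖slowForcing t‖ ≤ ξ·C_f·(‖r t‖ + 2ξ‖y t‖)`);
* `feedback_add_period`, `slowPert_add_period`, `continuous_slowPert`, `continuousOn_slowForcing`;
* **`integral_slowPert_eq`** — `∫ₐ^{a+P} slowPert = P • slowMean` for every `a` (the window means of `slowPert − slowMean` vanish EXACTLY).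
NOT a proof of any registered stub, of K1L_D, or of anomalous dissipation; rung F-D1.A0 infrastructure.
-/

set_option linter.dupNamespace false

noncomputable section

namespace Summit.AnomalousDissipation.AnomalousDissipation.Theorems.SolenoidalFractalHomogenisation.LagrangianStep.Sideband

open Set MeasureTheory Complex UnitAddTorus Filter Topology intervalIntegral
open scoped InnerProductSpace
open Literature.Analysis Literature.Analysis.FunctionSpaces Literature.Analysis.FunctionSpaces.Torus
open Literature.Analysis.FluidPDE Literature.Analysis.FluidPDE.Torus Literature.Analysis.FluidPDE.LatticeShear
open Summit.AnomalousDissipation.AnomalousDissipation.Theorems.SolenoidalFractalHomogenisation.LagrangianStep.CellChain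
  (modeRep continuousOn_modeRep norm_transversalProj_le)
open Summit.AnomalousDissipation.AnomalousDissipation.Theorems.SolenoidalFractalHomogenisation.PermissibleCarrier (period_pos)

variable {k₀ : ℕ}

/-! ## §1 The slow equation in forced form -/

/-- Algebra of the feedback term: `Σⱼ ξⱼ • P(fbⱼ (r + (Py − y) + Σ_{j'} ξ_{j'} • N_{j'} x)) = slowPert x − slowForcing` (all maps linear). [folklore] -/
theorem sum_feedback_split (W₁ : LatticeWord k₀) (n : ℕ) (ℓ : Fin 3 → ℤ) (𝔸 : Torus.Visc4 (Fin 3)) (R : ℕ)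
    (F : UnitAddTorus (Fin 3) → EuclideanSpace ℝ (Fin 3)) (w : ℝ → UnitAddTorus (Fin 3) → EuclideanSpace ℝ (Fin 3)) (t : ℝ) :
    ∑ j, ((xiCoeff W₁ n ℓ j : ℝ) : ℂ) • transversalProj ℓ (feedback W₁ R j t (sbVec W₁ n ((1 / (n : ℝ) ^ 2) • 𝔸) F w ℓ R t)) =
      slowPert W₁ n ℓ 𝔸 R t (modeRep W₁ n ((1 / (n : ℝ) ^ 2) • 𝔸) F w ℓ t) - slowForcing W₁ n ℓ 𝔸 R F w t := by
  have hZ : sbVec W₁ n ((1 / (n : ℝ) ^ 2) • 𝔸) F w ℓ R t =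
      (residualX W₁ n ℓ 𝔸 R F w t + (projX n ℓ R (refState W₁ n ℓ 𝔸 R F w t) - refState W₁ n ℓ 𝔸 R F w t)) +
        refState W₁ n ℓ 𝔸 R F w t := by
    rw [residualX_apply]; abel
  rw [hZ, slowForcing_def, slowPert_apply, sub_neg_eq_add]
  rw [← Finset.sum_add_distrib]
  refine Finset.sum_congr rfl fun j _ => ?_
  rw [map_add, map_add, smul_add, add_comm, refState_def, map_sum, map_sum, Finset.smul_sum]
  congr 1
  refine Finset.sum_congr rfl fun j' _ => ?_
  rw [map_smul, map_smul, smul_smul, ← Complex.ofReal_mul, Complex.coe_smul]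

/-- **THE SLOW EQUATION IN FORCED FORM**: on `(0,T)` (every `±mⱼ` retained, `𝔹 = (1/n²)•𝔸`),
`x' = −(4π² P_ℓ T_{𝔹ᵀ}(ℓ) x + slowPert t x) + slowForcing t`. [cite: MajdaKramer1999, §2.2.1.3 (55)] [cite: SandersVerhulstMurdock2007, Theorem 2.8.1] -/
theorem hasDerivAt_slow_forced (W₁ : LatticeWord k₀) (n : ℕ) {T : ℝ} {𝔸 : Torus.Visc4 (Fin 3)}
    {F : UnitAddTorus (Fin 3) → EuclideanSpace ℝ (Fin 3)} {w : ℝ → UnitAddTorus (Fin 3) → EuclideanSpace ℝ (Fin 3)}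
    (h : Torus.IsWeakTensorPassiveVectorOn 0 T ((1 / (n : ℝ) ^ 2) • 𝔸) (W₁.cell n) F w) (hF : Integrable F volume) (ℓ : Fin 3 → ℤ) {R : ℕ}
    (hbox : ∀ j, (W₁.phase j).m ∈ box R) {t : ℝ} (ht : t ∈ Ioo 0 T) :
    HasDerivAt (modeRep W₁ n ((1 / (n : ℝ) ^ 2) • 𝔸) F w ℓ)
      (-((((4 * Real.pi ^ 2 : ℝ) : ℂ)) • transversalProj ℓ (Torus.symbT (Torus.majorTranspose ((1 / (n : ℝ) ^ 2) • 𝔸)) ℓ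
            (modeRep W₁ n ((1 / (n : ℝ) ^ 2) • 𝔸) F w ℓ t)) +
          slowPert W₁ n ℓ 𝔸 R t (modeRep W₁ n ((1 / (n : ℝ) ^ 2) • 𝔸) F w ℓ t)) +
        slowForcing W₁ n ℓ 𝔸 R F w t) t := by
  refine (hasDerivAt_slowRep W₁ n h hF ℓ hbox ht).congr_deriv ?_
  rw [sum_feedback_split]
  abel

/-! ## §2 Sizes -/

/-- `‖feedbackⱼ(t)‖ ≤ 4π‖αⱼ‖` (operator norm). [cite: MajdaKramer1999, §2.2.1.3 (55)] -/
theorem opNorm_feedback_le (W₁ : LatticeWord k₀) (R : ℕ) (j : Fin k₀) (t : ℝ) :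
    ‖feedback W₁ R j t‖ ≤ 4 * Real.pi * ‖slotAmp W₁ j‖ :=
  ContinuousLinearMap.opNorm_le_bound _ (by positivity) fun y => norm_feedback_apply_le W₁ R j t y

/-- **`‖slowPert t‖ ≤ ξ²·C_f·C_N`** (`C_f = Σⱼ 4π‖αⱼ‖`, `C_N = Σⱼ 8π‖αⱼ‖/min(1,4π²lo)`). [cite: SandersVerhulstMurdock2007, Theorem 2.8.1] -/
theorem norm_slowPert_le (W₁ : LatticeWord k₀) (n : ℕ) (ℓ : Fin 3 → ℤ) {𝔸 : Torus.Visc4 (Fin 3)} {lo hi : ℝ}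
    (h𝔸 : Torus.NearIso 𝔸 lo hi) (hlo : 0 < lo) (R : ℕ) (t : ℝ) :
    ‖slowPert W₁ n ℓ 𝔸 R t‖ ≤ (Real.sqrt (freqNormSq ℓ) / n) ^ 2 *
      (∑ j, 4 * Real.pi * ‖slotAmp W₁ j‖) * (∑ j, 8 * Real.pi * ‖slotAmp W₁ j‖ / min 1 (4 * Real.pi ^ 2 * lo)) := by
  have hmin : 0 < min 1 (4 * Real.pi ^ 2 * lo) := lt_min one_pos (by positivity)
  have hξ : 0 ≤ Real.sqrt (freqNormSq ℓ) / n := by positivity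
  have hC : 0 ≤ (Real.sqrt (freqNormSq ℓ) / n) ^ 2 *
      (∑ j, 4 * Real.pi * ‖slotAmp W₁ j‖) * (∑ j, 8 * Real.pi * ‖slotAmp W₁ j‖ / min 1 (4 * Real.pi ^ 2 * lo)) := by
    refine mul_nonneg (mul_nonneg (sq_nonneg _) (Finset.sum_nonneg fun j _ => by positivity))
      (Finset.sum_nonneg fun j _ => by positivity)
  refine ContinuousLinearMap.opNorm_le_bound _ hC fun v => ?_
  rw [slowPert_apply]
  refine (norm_sum_le _ _).trans ?_
  have hterm : ∀ j j', ‖(xiCoeff W₁ n ℓ j * xiCoeff W₁ n ℓ j') • transversalProj ℓ (feedback W₁ R j t (responseExt W₁ 𝔸 1 R j' t v))‖ ≤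
      (Real.sqrt (freqNormSq ℓ) / n) ^ 2 * ((4 * Real.pi * ‖slotAmp W₁ j‖) *
        ((8 * Real.pi * ‖slotAmp W₁ j'‖ / min 1 (4 * Real.pi ^ 2 * lo)) * ‖v‖)) := by
    intro j j'
    rw [norm_smul, norm_mul, Real.norm_eq_abs, Real.norm_eq_abs]
    have h1 := abs_xiCoeff_le W₁ n ℓ j
    have h2 := abs_xiCoeff_le W₁ n ℓ j'
    have h3 : ‖transversalProj ℓ (feedback W₁ R j t (responseExt W₁ 𝔸 1 R j' t v))‖ ≤
        (4 * Real.pi * ‖slotAmp W₁ j‖) * ((8 * Real.pi * ‖slotAmp W₁ j'‖ / min 1 (4 * Real.pi ^ 2 * lo)) * ‖v‖) := by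
      refine (norm_transversalProj_le _ _).trans ((norm_feedback_apply_le W₁ R j t _).trans ?_)
      refine mul_le_mul_of_nonneg_left ?_ (by positivity)
      exact (ContinuousLinearMap.le_opNorm _ _).trans
        (mul_le_mul_of_nonneg_right (norm_responseExt_le W₁ h𝔸 hlo one_pos R j' t) (norm_nonneg _))
    have h12 : |xiCoeff W₁ n ℓ j| * |xiCoeff W₁ n ℓ j'| ≤ (Real.sqrt (freqNormSq ℓ) / n) ^ 2 := by
      rw [sq]; exact mul_le_mul h1 h2 (abs_nonneg _) hξ
    exact mul_le_mul h12 h3 (norm_nonneg _) (sq_nonneg _)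
  calc ∑ j, ‖∑ j', (xiCoeff W₁ n ℓ j * xiCoeff W₁ n ℓ j') • transversalProj ℓ (feedback W₁ R j t (responseExt W₁ 𝔸 1 R j' t v))‖
      ≤ ∑ j, ∑ j', (Real.sqrt (freqNormSq ℓ) / n) ^ 2 * ((4 * Real.pi * ‖slotAmp W₁ j‖) *
          ((8 * Real.pi * ‖slotAmp W₁ j'‖ / min 1 (4 * Real.pi ^ 2 * lo)) * ‖v‖)) :=
        Finset.sum_le_sum fun j _ => (norm_sum_le _ _).trans (Finset.sum_le_sum fun j' _ => hterm j j')
    _ = ∑ j, ((Real.sqrt (freqNormSq ℓ) / n) ^ 2 * (∑ j', 8 * Real.pi * ‖slotAmp W₁ j'‖ / min 1 (4 * Real.pi ^ 2 * lo)) * ‖v‖) *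
          (4 * Real.pi * ‖slotAmp W₁ j‖) := by
        refine Finset.sum_congr rfl fun j _ => ?_
        rw [Finset.mul_sum, Finset.sum_mul, Finset.sum_mul]
        exact Finset.sum_congr rfl fun j' _ => by ring
    _ = (Real.sqrt (freqNormSq ℓ) / n) ^ 2 *
          (∑ j, 4 * Real.pi * ‖slotAmp W₁ j‖) * (∑ j, 8 * Real.pi * ‖slotAmp W₁ j‖ / min 1 (4 * Real.pi ^ 2 * lo)) * ‖v‖ := by
        rw [← Finset.mul_sum]; ring

/-- **The projection mismatch of the reference state is `O(ξ)`**: for a `z`-transversal `y` and `2|ℓ| ≤ n`, `‖projX y − y‖ ≤ 2ξ‖y‖`.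
[cite: Temam1984, Ch. III §1.1] -/
theorem norm_projX_sub_self_le {n : ℕ} (hn : n ≠ 0) {ℓ : Fin 3 → ℤ} (hℓ : 2 * Real.sqrt (freqNormSq ℓ) ≤ n) {R : ℕ} {y : Space R}
    (hy : ∀ z : box R, transversalProj z.1 (y z) = y z) :
    ‖projX n ℓ R y - y‖ ≤ 2 * (Real.sqrt (freqNormSq ℓ) / n) * ‖y‖ := by
  have hn0 : (0 : ℝ) < n := by exact_mod_cast Nat.pos_of_ne_zero hn
  have hξ : 0 ≤ Real.sqrt (freqNormSq ℓ) / n := by positivity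
  -- componentwise
  have hz : ∀ z : box R, ‖(projX n ℓ R y - y) z‖ ≤ 2 * (Real.sqrt (freqNormSq ℓ) / n) * ‖y z‖ := by
    intro z
    have hk : classFreq n ℓ z.1 ≠ 0 := by
      intro h0
      have h1 := sqrt_freqNormSq_classFreq_ge_half hℓ z
      rw [h0] at h1
      have hZ1 : 1 ≤ Real.sqrt (freqNormSq z.1) := by
        rw [← Real.sqrt_one]; exact Real.sqrt_le_sqrt (Torus.one_le_freqNormSq_of_ne_zero (ne_zero_of_mem_box z.2))
      have h2 : freqNormSq (0 : Fin 3 → ℤ) = 0 := by simp [freqNormSq]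
      rw [h2, Real.sqrt_zero] at h1
      nlinarith
    rw [PiLp.sub_apply, projX_apply, norm_sub_rev]
    have h := norm_sub_transversalProj_proj_le hk (classFreq n 0 z.1) (y z)
    rw [classFreq_sub_classFreq_zero, transversalProj_classFreq_zero hn, hy z] at h
    refine h.trans (mul_le_mul_of_nonneg_right ?_ (norm_nonneg _))
    -- `√|ℓ|²/√|k_z|² ≤ 2ξ`
    have h1 := sqrt_freqNormSq_classFreq_ge_half hℓ z
    have hZ1 : 1 ≤ Real.sqrt (freqNormSq z.1) := by
      rw [← Real.sqrt_one]; exact Real.sqrt_le_sqrt (Torus.one_le_freqNormSq_of_ne_zero (ne_zero_of_mem_box z.2))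
    have hkpos : 0 < Real.sqrt (freqNormSq (classFreq n ℓ z.1)) := Real.sqrt_pos.2 (freqNormSq_pos_of_ne_zero' hk)
    rw [div_le_iff₀ hkpos]
    have : (n : ℝ) / 2 ≤ Real.sqrt (freqNormSq (classFreq n ℓ z.1)) := by nlinarith [mul_le_mul_of_nonneg_left hZ1 hn0.le]
    calc Real.sqrt (freqNormSq ℓ) = (Real.sqrt (freqNormSq ℓ) / n) * ((n : ℝ) / 2) * 2 := by field_simp
      _ ≤ (Real.sqrt (freqNormSq ℓ) / n) * Real.sqrt (freqNormSq (classFreq n ℓ z.1)) * 2 := by gcongr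
      _ = 2 * (Real.sqrt (freqNormSq ℓ) / n) * Real.sqrt (freqNormSq (classFreq n ℓ z.1)) := by ring
  have hsq : ‖projX n ℓ R y - y‖ ^ 2 ≤ (2 * (Real.sqrt (freqNormSq ℓ) / n) * ‖y‖) ^ 2 := by
    rw [PiLp.norm_sq_eq_of_L2, mul_pow, PiLp.norm_sq_eq_of_L2, Finset.mul_sum]
    refine Finset.sum_le_sum fun z _ => ?_
    rw [← mul_pow]
    exact pow_le_pow_left₀ (norm_nonneg _) (hz z) 2
  exact (pow_le_pow_iff_left₀ (norm_nonneg _) (by positivity) two_ne_zero).1 hsq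

/-- **`‖slowForcing t‖ ≤ ξ·C_f·(‖r t‖ + 2ξ‖y t‖)`** (`2|ℓ| ≤ n`). [cite: SandersVerhulstMurdock2007, Theorem 2.8.1] -/
theorem norm_slowForcing_le (W₁ : LatticeWord k₀) {n : ℕ} (hn : n ≠ 0) {ℓ : Fin 3 → ℤ} (hℓ : 2 * Real.sqrt (freqNormSq ℓ) ≤ n)
    {𝔸 : Torus.Visc4 (Fin 3)} {lo hi : ℝ} (h𝔸 : Torus.NearIso 𝔸 lo hi) (hlo : 0 < lo) (R : ℕ)
    (F : UnitAddTorus (Fin 3) → EuclideanSpace ℝ (Fin 3)) (w : ℝ → UnitAddTorus (Fin 3) → EuclideanSpace ℝ (Fin 3)) (t : ℝ) :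
    ‖slowForcing W₁ n ℓ 𝔸 R F w t‖ ≤ (Real.sqrt (freqNormSq ℓ) / n) * (∑ j, 4 * Real.pi * ‖slotAmp W₁ j‖) *
      (‖residualX W₁ n ℓ 𝔸 R F w t‖ + 2 * (Real.sqrt (freqNormSq ℓ) / n) * ‖refState W₁ n ℓ 𝔸 R F w t‖) := by
  have hξ : 0 ≤ Real.sqrt (freqNormSq ℓ) / n := by positivity
  have hyT := fun z => transversalProj_refState_apply W₁ ℓ h𝔸 hlo R F w t z (n := n)
  have hmis := norm_projX_sub_self_le hn hℓ hyT
  have hv : ‖residualX W₁ n ℓ 𝔸 R F w t + (projX n ℓ R (refState W₁ n ℓ 𝔸 R F w t) - refState W₁ n ℓ 𝔸 R F w t)‖ ≤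
      ‖residualX W₁ n ℓ 𝔸 R F w t‖ + 2 * (Real.sqrt (freqNormSq ℓ) / n) * ‖refState W₁ n ℓ 𝔸 R F w t‖ :=
    (norm_add_le _ _).trans (add_le_add le_rfl hmis)
  rw [slowForcing_def, norm_neg]
  refine (norm_sum_le _ _).trans ?_
  rw [Finset.mul_sum, Finset.sum_mul]
  refine Finset.sum_le_sum fun j _ => ?_
  rw [norm_smul, Complex.norm_real, Real.norm_eq_abs]
  have h1 := abs_xiCoeff_le W₁ n ℓ j
  have h2 : ‖transversalProj ℓ (feedback W₁ R j t
      (residualX W₁ n ℓ 𝔸 R F w t + (projX n ℓ R (refState W₁ n ℓ 𝔸 R F w t) - refState W₁ n ℓ 𝔸 R F w t)))‖ ≤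
      4 * Real.pi * ‖slotAmp W₁ j‖ *
        (‖residualX W₁ n ℓ 𝔸 R F w t‖ + 2 * (Real.sqrt (freqNormSq ℓ) / n) * ‖refState W₁ n ℓ 𝔸 R F w t‖) :=
    (norm_transversalProj_le ℓ _).trans ((norm_feedback_apply_le W₁ R j t _).trans
      (mul_le_mul_of_nonneg_left hv (by positivity)))
  calc |xiCoeff W₁ n ℓ j| * ‖transversalProj ℓ (feedback W₁ R j t
        (residualX W₁ n ℓ 𝔸 R F w t + (projX n ℓ R (refState W₁ n ℓ 𝔸 R F w t) - refState W₁ n ℓ 𝔸 R F w t)))‖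
      ≤ (Real.sqrt (freqNormSq ℓ) / n) * (4 * Real.pi * ‖slotAmp W₁ j‖ *
          (‖residualX W₁ n ℓ 𝔸 R F w t‖ + 2 * (Real.sqrt (freqNormSq ℓ) / n) * ‖refState W₁ n ℓ 𝔸 R F w t‖)) :=
        mul_le_mul h1 h2 (norm_nonneg _) hξ
    _ = _ := by ring

/-! ## §3 Periodicity, continuity -/

/-- The feedback functional is `P`-periodic. [cite: MajdaKramer1999, §2.2.1.3 (55)] -/
theorem feedback_add_period (W₁ : LatticeWord k₀) (R : ℕ) (j : Fin k₀) (t : ℝ) :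
    feedback W₁ R j (t + W₁.period) = feedback W₁ R j t := by
  unfold feedback
  rw [slotEnvelope_add_period]

/-- `slowPert` is `P`-periodic. [cite: SandersVerhulstMurdock2007, Theorem 2.8.1] -/
theorem slowPert_add_period (W₁ : LatticeWord k₀) (n : ℕ) (ℓ : Fin 3 → ℤ) (𝔸 : Torus.Visc4 (Fin 3)) (R : ℕ) (t : ℝ) :
    slowPert W₁ n ℓ 𝔸 R (t + W₁.period) = slowPert W₁ n ℓ 𝔸 R t := by
  unfold slowPert
  simp only [feedback_add_period, responseExt_add_period]

/-- `slowPert` is periodic (as a `Function.Periodic`). [cite: SandersVerhulstMurdock2007, Theorem 2.8.1] -/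
theorem periodic_slowPert (W₁ : LatticeWord k₀) (n : ℕ) (ℓ : Fin 3 → ℤ) (𝔸 : Torus.Visc4 (Fin 3)) (R : ℕ) :
    Function.Periodic (slowPert W₁ n ℓ 𝔸 R) W₁.period := fun t => slowPert_add_period W₁ n ℓ 𝔸 R t

/-- `slowPert` is continuous in time (operator norm). [cite: SandersVerhulstMurdock2007, Theorem 2.8.1] -/
theorem continuous_slowPert (W₁ : LatticeWord k₀) (n : ℕ) (ℓ : Fin 3 → ℤ) {𝔸 : Torus.Visc4 (Fin 3)} {lo hi : ℝ}
    (h𝔸 : Torus.NearIso 𝔸 lo hi) (hlo : 0 < lo) (R : ℕ) : Continuous (slowPert W₁ n ℓ 𝔸 R) := by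
  have hN : ∀ j, IsPeriodicResponse W₁ 𝔸 1 R j (response W₁ 𝔸 1 R j) := fun j => isPeriodicResponse_response_of_nearIso W₁ h𝔸 hlo one_pos R j
  unfold slowPert
  refine continuous_finsetSum _ fun j _ => continuous_finsetSum _ fun j' _ => ?_
  have hf : Continuous fun t => ((transversalProj ℓ).comp (feedback W₁ R j t)).restrictScalars ℝ :=
    (ContinuousLinearMap.restrictScalarsIsometry ℂ (Space R) (EuclideanSpace ℂ (Fin 3)) ℝ ℝ).continuous.comp
      ((ContinuousLinearMap.compL ℂ (Space R) (EuclideanSpace ℂ (Fin 3)) (EuclideanSpace ℂ (Fin 3)) (transversalProj ℓ)).continuous.comp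
        (continuous_feedback W₁ R j))
  have hjj : Continuous fun t => (((transversalProj ℓ).comp (feedback W₁ R j t)).restrictScalars ℝ).comp (responseExt W₁ 𝔸 1 R j' t) :=
    hf.clm_comp (continuous_responseExt W₁ 𝔸 1 R j' (hN j'))
  exact hjj.const_smul (xiCoeff W₁ n ℓ j * xiCoeff W₁ n ℓ j')

/-- The forcing is continuous on `[0,T]`. [cite: SandersVerhulstMurdock2007, Theorem 2.8.1] -/
theorem continuousOn_slowForcing (W₁ : LatticeWord k₀) {n : ℕ} (ℓ : Fin 3 → ℤ) {𝔸 : Torus.Visc4 (Fin 3)} {lo hi : ℝ}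
    (h𝔸 : Torus.NearIso 𝔸 lo hi) (hlo : 0 < lo) (R : ℕ) {T : ℝ} (hT : 0 ≤ T)
    {F : UnitAddTorus (Fin 3) → EuclideanSpace ℝ (Fin 3)} {w : ℝ → UnitAddTorus (Fin 3) → EuclideanSpace ℝ (Fin 3)}
    (h : Torus.IsWeakTensorPassiveVectorOn 0 T ((1 / (n : ℝ) ^ 2) • 𝔸) (W₁.cell n) F w) :
    ContinuousOn (slowForcing W₁ n ℓ 𝔸 R F w) (Icc 0 T) := by
  have hfun : slowForcing W₁ n ℓ 𝔸 R F w = fun t => -∑ j, ((xiCoeff W₁ n ℓ j : ℝ) : ℂ) • transversalProj ℓ (feedback W₁ R j t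
      (residualX W₁ n ℓ 𝔸 R F w t + (projX n ℓ R (refState W₁ n ℓ 𝔸 R F w t) - refState W₁ n ℓ 𝔸 R F w t))) := rfl
  rw [hfun]
  have hv : ContinuousOn (fun t => residualX W₁ n ℓ 𝔸 R F w t +
      (projX n ℓ R (refState W₁ n ℓ 𝔸 R F w t) - refState W₁ n ℓ 𝔸 R F w t)) (Icc 0 T) :=
    (continuousOn_residualX W₁ ℓ h𝔸 hlo R hT h).add
      (((projX n ℓ R).continuous.comp_continuousOn (continuousOn_refState W₁ ℓ h𝔸 hlo R hT h)).sub
        (continuousOn_refState W₁ ℓ h𝔸 hlo R hT h))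
  refine (continuousOn_finsetSum _ fun j _ => ?_).neg
  have hj : ContinuousOn (fun t => transversalProj ℓ (feedback W₁ R j t
      (residualX W₁ n ℓ 𝔸 R F w t + (projX n ℓ R (refState W₁ n ℓ 𝔸 R F w t) - refState W₁ n ℓ 𝔸 R F w t)))) (Icc 0 T) :=
    (transversalProj ℓ).continuous.comp_continuousOn (((continuous_feedback W₁ R j).continuousOn).clm_apply hv)
  exact hj.const_smul (((xiCoeff W₁ n ℓ j : ℝ) : ℂ))

/-! ## §4 The window means of the perturbation -/

/-- On `[0,P]` the periodic extension IS the response (they agree at `P` by the closing condition). [cite: SandersVerhulstMurdock2007, Lemma 5.2.7] -/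
theorem responseExt_eq_response_of_mem_Icc (W₁ : LatticeWord k₀) (𝔸 : Torus.Visc4 (Fin 3)) (γ₁ : ℝ) (R : ℕ) (j : Fin k₀)
    (hN : IsPeriodicResponse W₁ 𝔸 γ₁ R j (response W₁ 𝔸 γ₁ R j)) {t : ℝ} (ht : t ∈ Icc 0 W₁.period) :
    responseExt W₁ 𝔸 γ₁ R j t = response W₁ 𝔸 γ₁ R j t := by
  rcases ht.2.eq_or_lt with h | h
  · rw [h, hN.2.2]
    have := responseExt_add_period W₁ 𝔸 γ₁ R j 0
    rw [zero_add] at this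
    rw [this, responseExt_of_mem_Ico W₁ 𝔸 γ₁ R j ⟨le_rfl, period_pos W₁⟩]
  · exact responseExt_of_mem_Ico W₁ 𝔸 γ₁ R j ⟨ht.1, h⟩

/-- **THE WINDOW MEANS OF THE PERTURBATION**: `∫ₐ^{a+P} slowPert = P • slowMean` for every `a` (so `slowPert − slowMean` has ZERO window means).
[cite: MajdaKramer1999, §2.2.1.3 (55) (effective diffusivity as a cell average)] [cite: SandersVerhulstMurdock2007, Lemma 2.8.2 (Besjes)] -/
theorem integral_slowPert_eq (W₁ : LatticeWord k₀) (n : ℕ) (ℓ : Fin 3 → ℤ) {𝔸 : Torus.Visc4 (Fin 3)} {lo hi : ℝ}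
    (h𝔸 : Torus.NearIso 𝔸 lo hi) (hlo : 0 < lo) (R : ℕ) (a : ℝ) :
    ∫ s in a..a + W₁.period, slowPert W₁ n ℓ 𝔸 R s = W₁.period • slowMean W₁ n ℓ 𝔸 R := by
  have hP := period_pos W₁
  have hN : ∀ j, IsPeriodicResponse W₁ 𝔸 1 R j (response W₁ 𝔸 1 R j) := fun j => isPeriodicResponse_response_of_nearIso W₁ h𝔸 hlo one_pos R j
  -- move the window to `[0,P]`
  rw [(periodic_slowPert W₁ n ℓ 𝔸 R).intervalIntegral_add_eq a 0, zero_add]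
  -- the integrand on `[0,P]`, slot by slot
  set Φ : Fin k₀ → Fin k₀ → ℝ → (EuclideanSpace ℂ (Fin 3) →L[ℝ] EuclideanSpace ℂ (Fin 3)) := fun j j' s =>
    (((transversalProj ℓ).comp (feedback W₁ R j s)).restrictScalars ℝ).comp (responseExt W₁ 𝔸 1 R j' s) with hΦ
  have hΦc : ∀ j j', Continuous (Φ j j') := fun j j' =>
    ((ContinuousLinearMap.restrictScalarsIsometry ℂ (Space R) (EuclideanSpace ℂ (Fin 3)) ℝ ℝ).continuous.comp
      ((ContinuousLinearMap.compL ℂ (Space R) (EuclideanSpace ℂ (Fin 3)) (EuclideanSpace ℂ (Fin 3)) (transversalProj ℓ)).continuous.comp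
        (continuous_feedback W₁ R j))).clm_comp (continuous_responseExt W₁ 𝔸 1 R j' (hN j'))
  have hfun : slowPert W₁ n ℓ 𝔸 R = fun s => ∑ j, ∑ j', (xiCoeff W₁ n ℓ j * xiCoeff W₁ n ℓ j') • Φ j j' s := rfl
  have hI' : ∀ j j', IntervalIntegrable (fun x => (xiCoeff W₁ n ℓ j * xiCoeff W₁ n ℓ j') • Φ j j' x) volume 0 W₁.period :=
    fun j j' => ((hΦc j j').const_smul (xiCoeff W₁ n ℓ j * xiCoeff W₁ n ℓ j')).intervalIntegrable _ _
  have hI : ∀ j, IntervalIntegrable (fun x => ∑ j', (xiCoeff W₁ n ℓ j * xiCoeff W₁ n ℓ j') • Φ j j' x) volume 0 W₁.period :=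
    fun j => (continuous_finsetSum _ fun j' _ =>
      (hΦc j j').const_smul (xiCoeff W₁ n ℓ j * xiCoeff W₁ n ℓ j')).intervalIntegrable _ _
  rw [hfun]
  beta_reduce
  rw [intervalIntegral.integral_finsetSum fun j _ => hI j]
  rw [slowMean_def, Finset.smul_sum]
  refine Finset.sum_congr rfl fun j _ => ?_
  rw [intervalIntegral.integral_finsetSum fun j' _ => hI' j j', Finset.smul_sum]
  refine Finset.sum_congr rfl fun j' _ => ?_
  rw [intervalIntegral.integral_smul, smul_comm]
  refine congrArg (fun X => (xiCoeff W₁ n ℓ j * xiCoeff W₁ n ℓ j') • X) ?_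
  -- `∫₀ᴾ P_ℓ ∘ fbⱼ ∘ N_{j'} = P • P_ℓ ∘ M_{jj'}`
  set Pr : EuclideanSpace ℂ (Fin 3) →L[ℝ] EuclideanSpace ℂ (Fin 3) := (transversalProj ℓ).restrictScalars ℝ with hPr
  set Lc := ContinuousLinearMap.compL ℝ (EuclideanSpace ℂ (Fin 3)) (EuclideanSpace ℂ (Fin 3)) (EuclideanSpace ℂ (Fin 3)) Pr with hLc
  have hL : ∀ s, Φ j j' s = Lc (((feedback W₁ R j s).restrictScalars ℝ).comp (responseExt W₁ 𝔸 1 R j' s)) := by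
    intro s
    rw [hLc, ContinuousLinearMap.compL_apply]
    ext v
    rfl
  simp_rw [hL]
  rw [ContinuousLinearMap.intervalIntegral_comp_comm]
  · rw [hLc, ContinuousLinearMap.compL_apply]
    -- `P • (Pr ∘ ((1/P) • X)) = Pr ∘ X`
    have hX : W₁.period • Pr.comp (meanFeedback W₁ 𝔸 1 R j j') =
        Pr.comp (∫ t in (0:ℝ)..W₁.period, ((feedback W₁ R j t).restrictScalars ℝ).comp (response W₁ 𝔸 1 R j' t)) := by
      rw [meanFeedback, ContinuousLinearMap.comp_smul, smul_smul, mul_one_div_cancel hP.ne', one_smul]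
    rw [hX]
    refine congrArg (fun X => Pr.comp X) (intervalIntegral.integral_congr fun s hs => ?_)
    rw [uIcc_of_le hP.le] at hs
    simp only [responseExt_eq_response_of_mem_Icc W₁ 𝔸 1 R j' (hN j') hs]
  · have hc : Continuous fun s => ((feedback W₁ R j s).restrictScalars ℝ).comp (responseExt W₁ 𝔸 1 R j' s) :=
      ((ContinuousLinearMap.restrictScalarsIsometry ℂ (Space R) (EuclideanSpace ℂ (Fin 3)) ℝ ℝ).continuous.comp
        (continuous_feedback W₁ R j)).clm_comp (continuous_responseExt W₁ 𝔸 1 R j' (hN j'))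
    exact hc.intervalIntegrable _ _

end Summit.AnomalousDissipation.AnomalousDissipation.Theorems.SolenoidalFractalHomogenisation.LagrangianStep.Sideband

end
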